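import Literature.Analysis.FluidPDE.FluidComputer.Dealiasing
import Literature.Analysis.FluidPDE.FluidComputer.EnergyParseval
import Literature.Analysis.FluidPDE.FluidComputer.EnstrophyCurvature

/-!
# The rotational form `u × ω`: after Leray projection (dns-A) or a curl (dns-B) the dealiased pseudo-spectral Lamb vector IS the Galerkin advection term

HONEST FRAMING (cell `pub-fluidc`, verbatim): *low prior, high value-of-information experiment on
Tao's machine paradigm; NOT a claim that NS blows up.* No statement about the Navier–Stokes evolution
is made here. `Dealiasing` proved that a 2/3-dealiased cubic-mask pseudo-spectral product is the exact
Galerkin convolution, and drew the consequence for the DIVERGENCE form `-i k_β (u_β u_α)^`. Both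
engines of the cell, however, evaluate the nonlinearity in ROTATIONAL form: dns-A integrates
`du/dt = P[u × ω] + νΔu` (velocity formulation, `P` = Leray projector; HOME/code/dnsA/dnsa.py header),
dns-B integrates the vorticity equation with `r = u × ω` evaluated in physical space and `∇ × r`
(HOME/code/dnsB/dnsb.py header). This file closes that gap.

The printed fact is the vector identity behind the rotational form,
`u × ω = -(u·∇)u + ∇(|u|²/2)` for divergence-free `u` (the Lamb-vector / Bernoulli decomposition;
e.g. [cite: CanutoEtAl2007, §3.3] writes the Navier–Stokes nonlinearity in the equivalent convective,
divergence, rotational and skew-symmetric forms; [folklore]). At the level of TRUNCATED CONVOLUTIONS on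
a finite mode set `S`, for a coefficient field `û` supported in `S` (`∀ p ∉ S, û(p) = 0`), we PROVE:

* `rotational_eq` — `Σ_{q∈S} û(k-q) × ω̂(q) = N_S(k) + G(k) k` with `ω̂ = i q × û` (`EnergyParseval.curl`),
  `N_S = ShellTransfer.advection` and the Bernoulli scalar `G(k) = (i/2) Σ_{q∈S} û(k-q)·û(q)`
  (`gradPart`): BAC–CAB per triad, incompressibility of the mediator for the `(u·∇)u` part, and the
  involution `q ↦ k - q` on the supported triads for the gradient part (`sum_sub_mul_eq_zero`);
* `leray_rotational` — hence **`P_k (u × ω)^_S(k) = P_k N_S(k)`**: the Leray-projected truncated Lamb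
  vector is the Leray-projected Galerkin advection term (`EnstrophyCurvature.leray`), i.e. exactly the
  inviscid rate `W(k)` of `EnstrophyCurvature.inviscidRate_coeff_eq_leray`;
* `kcross_rotational` — and **`k × (u × ω)^_S(k) = k × N_S(k)`** (the curl kills the gradient: dns-B's
  vorticity-form nonlinearity);
* `leray_pseudoSpectral_lamb` — combined with Orszag's exactness (`Dealiasing.coef_synth_mul_of_lt`):
  for `û` supported in the cubic mask `|k_i| ≤ K`, `3K < N`, and every retained `k`, the Leray projection
  of the `N³`-GRID pseudo-spectral Lamb vector (inverse FFT of `û` and `ω̂`, pointwise cross product,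
  forward FFT) equals `P_k N_S(k)` — what dns-A integrates is the Galerkin system of
  `GalerkinEnergyBalance` with the pressure multiplier `c(k) = k·N_S(k)/|k|²`; `kcross_pseudoSpectral_lamb`
  is the dns-B form.

Not modelled: time stepping, floating point, dns-B's Biot–Savart step `û = i k × ω̂/|k|²` (pure
bookkeeping on a `FourierVelocity`). No named facts (D-0026).
-/

noncomputable section

namespace Literature.Analysis.FluidPDE.FluidComputer

open Complex ComplexConjugate Finset
open scoped BigOperators

namespace ShellTransfer

/-! ## The complex cross product and BAC–CAB -/

/-- The (bilinear) cross product on `ℂ³`. [folklore] -/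
def ccross (a b : Fin 3 → ℂ) : Fin 3 → ℂ :=
  ![a 1 * b 2 - a 2 * b 1, a 2 * b 0 - a 0 * b 2, a 0 * b 1 - a 1 * b 0]

/-- **BAC–CAB with the vorticity factor**: `(a × (i q × b))_j = i (q_j (a·b) - b_j (q·a))`. [folklore] -/
theorem ccross_curl_apply (a b : Fin 3 → ℂ) (q : Fin 3 → ℤ) (j : Fin 3) :
    ccross a (fun i => I * kcross q b i) j = I * (((q j : ℤ) : ℂ) * cdot a b - b j * kdot q a) := by
  unfold cdot kdot
  fin_cases j <;> simp [ccross, kcross, Fin.sum_univ_three] <;> ring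

variable (U : FourierVelocity)

/-! ## The truncated Lamb vector and its decomposition -/

/-- **The truncated Lamb vector** `(u × ω)^_S(k)_j = Σ_{q∈S} (û(k-q) × ω̂(q))_j`, `ω̂ = curl û`: the
Galerkin convolution of velocity and vorticity (what a dealiased code's `u × ω` produces, by
`Dealiasing`). [folklore] -/
def rotational (S : Finset (Fin 3 → ℤ)) (k : Fin 3 → ℤ) : Fin 3 → ℂ :=
  fun j => ∑ q ∈ S, ccross (U.coeff (k - q)) ((curl U).coeff q) j

/-- **The Bernoulli scalar** `G(k) = (i/2) Σ_{q∈S} û(k-q)·û(q)` — the coefficient of `k` in the gradient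
part `(∇|u|²/2)^(k) = G(k) k`. [folklore] -/
def gradPart (S : Finset (Fin 3 → ℤ)) (k : Fin 3 → ℤ) : ℂ :=
  I / 2 * ∑ q ∈ S, cdot (U.coeff (k - q)) (U.coeff q)

/-- `cdot` is symmetric. [folklore] -/
theorem cdot_comm (a b : Fin 3 → ℂ) : cdot a b = cdot b a := by
  unfold cdot
  exact Finset.sum_congr rfl fun i _ => mul_comm _ _

/-- **The involution on supported triads.** For `û` supported in `S`, the weights `q_j - (k-q)_j` are odd
under `q ↦ k - q` while `û(k-q)·û(q)` is even and vanishes unless both `q, k - q ∈ S`; hence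
`Σ_{q∈S} (q_j - (k-q)_j) û(k-q)·û(q) = 0`. [folklore] -/
theorem sum_sub_mul_eq_zero (S : Finset (Fin 3 → ℤ)) (hU : ∀ p ∉ S, U.coeff p = 0) (k : Fin 3 → ℤ)
    (j : Fin 3) :
    ∑ q ∈ S, (((q j : ℤ) : ℂ) - (((k - q) j : ℤ) : ℂ)) * cdot (U.coeff (k - q)) (U.coeff q) = 0 := by
  -- restrict to the supported triads `T = {q ∈ S | k - q ∈ S}`
  set T := S.filter (fun q => k - q ∈ S) with hT
  have hrestrict : ∑ q ∈ S, (((q j : ℤ) : ℂ) - (((k - q) j : ℤ) : ℂ)) * cdot (U.coeff (k - q)) (U.coeff q) =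
      ∑ q ∈ T, (((q j : ℤ) : ℂ) - (((k - q) j : ℤ) : ℂ)) * cdot (U.coeff (k - q)) (U.coeff q) := by
    rw [hT, Finset.sum_filter]
    refine Finset.sum_congr rfl fun q _ => ?_
    split_ifs with h
    · rfl
    · rw [hU (k - q) h]
      unfold cdot
      simp
  rw [hrestrict]
  -- on `T`, pair `q` with `k - q`
  refine Finset.sum_involution (fun q _ => k - q) ?_ ?_ ?_ ?_
  · intro q _
    have e : k - (k - q) = q := sub_sub_cancel k q
    rw [e, cdot_comm (U.coeff q) (U.coeff (k - q))]
    ring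
  · intro q _ hne heq
    apply hne
    have e : k - q = q := heq
    rw [e, sub_self, zero_mul]
  · intro q hq
    rw [hT, Finset.mem_filter] at hq ⊢
    refine ⟨hq.2, ?_⟩
    rw [sub_sub_cancel]
    exact hq.1
  · intro q _
    exact sub_sub_cancel k q

/-- Consequently `Σ_{q∈S} q_j û(k-q)·û(q) = (k_j/2) Σ_{q∈S} û(k-q)·û(q)`. [folklore] -/
theorem sum_weight_eq_half (S : Finset (Fin 3 → ℤ)) (hU : ∀ p ∉ S, U.coeff p = 0) (k : Fin 3 → ℤ)
    (j : Fin 3) :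
    ∑ q ∈ S, ((q j : ℤ) : ℂ) * cdot (U.coeff (k - q)) (U.coeff q) =
      ((k j : ℤ) : ℂ) / 2 * ∑ q ∈ S, cdot (U.coeff (k - q)) (U.coeff q) := by
  have h := sum_sub_mul_eq_zero U S hU k j
  have e : ∑ q ∈ S, (((q j : ℤ) : ℂ) - (((k - q) j : ℤ) : ℂ)) * cdot (U.coeff (k - q)) (U.coeff q) =
      2 * ∑ q ∈ S, ((q j : ℤ) : ℂ) * cdot (U.coeff (k - q)) (U.coeff q) -
        ((k j : ℤ) : ℂ) * ∑ q ∈ S, cdot (U.coeff (k - q)) (U.coeff q) := by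
    rw [Finset.mul_sum, Finset.mul_sum, ← Finset.sum_sub_distrib]
    refine Finset.sum_congr rfl fun q _ => ?_
    simp only [Pi.sub_apply, Int.cast_sub]
    ring
  rw [e] at h
  have h2 : 2 * ∑ q ∈ S, ((q j : ℤ) : ℂ) * cdot (U.coeff (k - q)) (U.coeff q) =
      ((k j : ℤ) : ℂ) * ∑ q ∈ S, cdot (U.coeff (k - q)) (U.coeff q) := sub_eq_zero.mp h
  linear_combination (1 / 2 : ℂ) * h2

/-- **`u × ω = -(u·∇)u + ∇(|u|²/2)` at the level of truncated convolutions**: for `û` supported in `S`,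
`(u × ω)^_S(k)_j = N_S(k)_j + G(k) k_j`. [folklore] -/
theorem rotational_eq (S : Finset (Fin 3 → ℤ)) (hU : ∀ p ∉ S, U.coeff p = 0) (k : Fin 3 → ℤ) (j : Fin 3) :
    rotational U S k j = advection U S k j + gradPart U S k * ((k j : ℤ) : ℂ) := by
  unfold rotational advection gradPart
  have hterm : ∀ q ∈ S, ccross (U.coeff (k - q)) ((curl U).coeff q) j =
      I * (((q j : ℤ) : ℂ) * cdot (U.coeff (k - q)) (U.coeff q)) +
        (-I) * (kdot k (U.coeff (k - q)) * U.coeff q j) := by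
    intro q _
    have e : (curl U).coeff q = fun i => I * kcross q (U.coeff q) i := funext fun i => curl_coeff U q i
    rw [e, ccross_curl_apply, ← kdot_mediator U k q]
    ring
  rw [Finset.sum_congr rfl hterm, Finset.sum_add_distrib, ← Finset.mul_sum, ← Finset.mul_sum,
    sum_weight_eq_half U S hU k j]
  ring

/-! ## Leray projection and curl of the rotational term -/

/-- `P_k` is additive. [folklore] -/
theorem leray_add (k : Fin 3 → ℤ) (a b : Fin 3 → ℂ) : leray k (fun j => a j + b j) = fun j => leray k a j + leray k b j := by
  funext j
  simp only [leray_apply]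
  unfold kdot
  rw [show (∑ i, ((k i : ℤ) : ℂ) * (a i + b i)) = (∑ i, ((k i : ℤ) : ℂ) * a i) + ∑ i, ((k i : ℤ) : ℂ) * b i by
    rw [← Finset.sum_add_distrib]; exact Finset.sum_congr rfl fun i _ => by ring]
  ring

/-- `P_k (c k) = 0`: the Leray projection kills gradients. [folklore] -/
theorem leray_smul_self (k : Fin 3 → ℤ) (c : ℂ) : leray k (fun j => c * ((k j : ℤ) : ℂ)) = 0 := by
  funext j
  rw [leray_apply]
  by_cases hk : knormSq k = 0
  · have : k = 0 := (knormSq_eq_zero_iff k).mp hk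
    subst this
    simp
  · have hk' : (knormSq k : ℂ) ≠ 0 := by exact_mod_cast hk
    unfold kdot
    have e : ∑ i, ((k i : ℤ) : ℂ) * (c * ((k i : ℤ) : ℂ)) = c * (knormSq k : ℂ) := by
      rw [← sum_intCast_mul_self, Finset.mul_sum]
      exact Finset.sum_congr rfl fun i _ => by ring
    rw [e, mul_div_assoc, div_self hk']
    simp

/-- **`P_k (u × ω)^_S(k) = P_k N_S(k)`** — the Leray-projected truncated Lamb vector is the
Leray-projected Galerkin advection term (the inviscid rate of `EnstrophyCurvature`). [folklore] -/
theorem leray_rotational (S : Finset (Fin 3 → ℤ)) (hU : ∀ p ∉ S, U.coeff p = 0) (k : Fin 3 → ℤ) :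
    leray k (rotational U S k) = leray k (advection U S k) := by
  have e : rotational U S k = fun j => advection U S k j + gradPart U S k * ((k j : ℤ) : ℂ) :=
    funext fun j => rotational_eq U S hU k j
  rw [e, leray_add, leray_smul_self]
  funext j
  simp

/-- `k × (c k) = 0`. [folklore] -/
theorem kcross_smul_self (k : Fin 3 → ℤ) (c : ℂ) : kcross k (fun j => c * ((k j : ℤ) : ℂ)) = 0 := by
  funext j
  fin_cases j <;> simp [kcross] <;> ring

/-- `k ×` is additive. [folklore] -/
theorem kcross_add (k : Fin 3 → ℤ) (a b : Fin 3 → ℂ) :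
    kcross k (fun j => a j + b j) = fun j => kcross k a j + kcross k b j := by
  funext j
  fin_cases j <;> simp [kcross] <;> ring

/-- **`k × (u × ω)^_S(k) = k × N_S(k)`** — the curl of the truncated Lamb vector is the curl of the
Galerkin advection term (dns-B's vorticity-form nonlinearity). [folklore] -/
theorem kcross_rotational (S : Finset (Fin 3 → ℤ)) (hU : ∀ p ∉ S, U.coeff p = 0) (k : Fin 3 → ℤ) :
    kcross k (rotational U S k) = kcross k (advection U S k) := by
  have e : rotational U S k = fun j => advection U S k j + gradPart U S k * ((k j : ℤ) : ℂ) :=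
    funext fun j => rotational_eq U S hU k j
  rw [e, kcross_add, kcross_smul_self]
  funext j
  simp

/-! ## With the grid: the dealiased pseudo-spectral Lamb vector -/

namespace Dealiasing

variable {N : ℕ} [NeZero N]

/-- `coef` is additive in the grid function. [folklore] -/
theorem coef_sub (g h : (Fin 3 → ZMod N) → ℂ) (k : Fin 3 → ℤ) :
    coef N (fun n => g n - h n) k = coef N g k - coef N h k := by
  unfold coef
  rw [← sub_div, ← Finset.sum_sub_distrib]
  congr 1
  exact Finset.sum_congr rfl fun n _ => by ring

/-- **The pseudo-spectral Lamb vector**: synthesize `û` and `ω̂ = curl û` on the `N³` grid, take the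
pointwise cross product, transform back: component `j` at mode `k`. [folklore] -/
def psLamb (N : ℕ) [NeZero N] (U : FourierVelocity) (B : Finset (Fin 3 → ℤ)) (k : Fin 3 → ℤ) (j : Fin 3) : ℂ :=
  coef N (fun n => ccross (fun a => synth B (fun p => U.coeff p a) n)
    (fun b => synth B (fun p => (curl U).coeff p b) n) j) k

/-- Under the 2/3 rule the pseudo-spectral Lamb vector is the truncated Lamb vector exactly:
`psLamb = rotational` on the retained modes. [cite: Orszag1971] [cite: CanutoEtAl2007, §3.3.2] -/
theorem psLamb_eq_rotational {K : ℕ} (hK : 3 * K < N) {B : Finset (Fin 3 → ℤ)} (hB : B ⊆ box K)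
    (U : FourierVelocity) (hU : ∀ p ∉ B, U.coeff p = 0) {k : Fin 3 → ℤ} (hk : k ∈ box K) (j : Fin 3) :
    psLamb N U B k j = rotational U B k j := by
  -- each product `u_a ω_b` is alias-free
  have hprod : ∀ a b : Fin 3, coef N (fun n => synth B (fun p => U.coeff p a) n *
      synth B (fun p => (curl U).coeff p b) n) k = ∑ q ∈ B, U.coeff (k - q) a * (curl U).coeff q b := by
    intro a b
    rw [coef_synth_mul_of_lt hK hB _ _ hk]
    exact sum_sum_ite_eq_sum_sub (fun p => U.coeff p a) (fun q => (curl U).coeff q b)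
      (fun p hp => by rw [hU p hp]; rfl) k
  unfold psLamb rotational
  fin_cases j
  · show coef N (fun n => synth B (fun p => U.coeff p 1) n * synth B (fun p => (curl U).coeff p 2) n -
        synth B (fun p => U.coeff p 2) n * synth B (fun p => (curl U).coeff p 1) n) k =
      ∑ q ∈ B, (U.coeff (k - q) 1 * (curl U).coeff q 2 - U.coeff (k - q) 2 * (curl U).coeff q 1)
    rw [coef_sub, hprod, hprod, ← Finset.sum_sub_distrib]
  · show coef N (fun n => synth B (fun p => U.coeff p 2) n * synth B (fun p => (curl U).coeff p 0) n -
        synth B (fun p => U.coeff p 0) n * synth B (fun p => (curl U).coeff p 2) n) k =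
      ∑ q ∈ B, (U.coeff (k - q) 2 * (curl U).coeff q 0 - U.coeff (k - q) 0 * (curl U).coeff q 2)
    rw [coef_sub, hprod, hprod, ← Finset.sum_sub_distrib]
  · show coef N (fun n => synth B (fun p => U.coeff p 0) n * synth B (fun p => (curl U).coeff p 1) n -
        synth B (fun p => U.coeff p 1) n * synth B (fun p => (curl U).coeff p 0) n) k =
      ∑ q ∈ B, (U.coeff (k - q) 0 * (curl U).coeff q 1 - U.coeff (k - q) 1 * (curl U).coeff q 0)
    rw [coef_sub, hprod, hprod, ← Finset.sum_sub_distrib]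

/-- **dns-A's right-hand side is the Galerkin one.** For `û` supported in the cubic mask `|k_i| ≤ K`,
`3K < N`, and every retained `k`: `P_k (PS[u × ω])(k) = P_k N_B(k)` — the Leray-projected dealiased
pseudo-spectral Lamb vector equals the Leray-projected Galerkin advection term. [cite: Orszag1971]
[cite: CanutoEtAl2007, §3.3.2] -/
theorem leray_pseudoSpectral_lamb {K : ℕ} (hK : 3 * K < N) {B : Finset (Fin 3 → ℤ)} (hB : B ⊆ box K)
    (U : FourierVelocity) (hU : ∀ p ∉ B, U.coeff p = 0) {k : Fin 3 → ℤ} (hk : k ∈ box K) :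
    leray k (psLamb N U B k) = leray k (advection U B k) := by
  have e : psLamb N U B k = rotational U B k := funext fun j => psLamb_eq_rotational hK hB U hU hk j
  rw [e, leray_rotational U B hU k]

/-- **dns-B's form**: `k × (PS[u × ω])(k) = k × N_B(k)` (the vorticity equation's nonlinearity is the
curl of the Galerkin advection term). [cite: Orszag1971] [cite: CanutoEtAl2007, §3.3.2] -/
theorem kcross_pseudoSpectral_lamb {K : ℕ} (hK : 3 * K < N) {B : Finset (Fin 3 → ℤ)} (hB : B ⊆ box K)
    (U : FourierVelocity) (hU : ∀ p ∉ B, U.coeff p = 0) {k : Fin 3 → ℤ} (hk : k ∈ box K) :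
    kcross k (psLamb N U B k) = kcross k (advection U B k) := by
  have e : psLamb N U B k = rotational U B k := funext fun j => psLamb_eq_rotational hK hB U hU hk j
  rw [e, kcross_rotational U B hU k]

end Dealiasing

end ShellTransfer

end Literature.Analysis.FluidPDE.FluidComputer

end
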